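import Literature.NumberTheory.LFunctions.MatomakiRadziwillTaoT2OfVK
import Literature.NumberTheory.LFunctions.VinogradovZetaSumEstimate
import HarnessLib

/-!
# Tao 2016, (1.2) for `μ` (log-averaged two-point Chowla, Möbius) proved: `tao_log_chowla_moebius_holds`

Topic `Literature/NumberTheory/Sieve`; sibling proof file (one theorem, no new definitions, no named facts) of
`ParityWave0.lean` for the Wave-0 named fact `Literature.NumberTheory.Sieve.tao_log_chowla_moebius`
(**parity.S21**, Möbius form): T. Tao, *The logarithmically averaged Chowla and Elliott conjectures for
two-point correlations*, Forum Math. Pi **4** (2016), e8 = arXiv:1509.05422, §1, paragraph after Remark 1.6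
("Corollary 1.5 also implies the asymptotic `∑_{n ≤ x} g₁(n) g₂(n+1)/n = o(log x)` … when at least one of
`g₁, g₂` is equal to the Möbius function"; the tree's fact is the instance `g₁ = g₂ = μ` of Corollary 1.5
with `a₁ = a₂ = 1`, `b₁ = 0`, `b₂ = h`): for every shift `h ≥ 1`, `∑_{n ≤ x} μ(n) μ(n + h) / n = o(log x)`.

The tree already contains the whole printed deduction; this file only joins its two leaves, which live in
modules neither of which imports the other (the companion of `ParityWave0LogChowlaLiouvilleHolds.lean`):

* `MatomakiRadziwillTaoT2OfVK.lean`: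
  `LFunctions.MRT2015.tao_log_chowla_moebius_of_vk :
     0 < c → LFunctions.HasVKZeroFreeRegion c T₀ → Sieve.tao_log_chowla_moebius`
  — from ANY Vinogradov–Korobov zero-free region for Dirichlet `L`-functions: Corollary 1.5 / Theorem 1.3
  (`tao_log_averaged_elliott_two_of_prop24`, the §2 reductions `Tao2016_section2_reduction_holds`, Theorem 2.3
  with the proved core `Tao2016.Tao2016_theorem23_core_holds` — Lemma 2.5, Proposition 2.6, the entropy
  decrement argument and §3), applied to `μ` (non-pretentious: `Tao2016_moebiusNonpretentious_holds`,
  `tao_log_chowla_moebius_of_elliott_two`); Proposition 2.4 (`MRT2015.Tao2016_prop24_of_vk`) from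
  Matomäki–Radziwiłł–Tao 2015, Theorem 1.7, Theorem A.2 and Proposition A.3 in the restricted-Halász form
  with middle term `K (1 + M) e^{-M/2}` (`MRT2015.propA3With_exp_half_of_vk`);
* `VinogradovZetaSumEstimate.lean`: `LFunctions.VKZeta.exists_hasVKZeroFreeRegion : ∃ c > 0, HasVKZeroFreeRegion c 21`
  — the Vinogradov–Korobov region, unconditionally, from the tree's Vinogradov mean value theorem
  (`vmvtBound_thirtyTwo`) through Ivić's Theorem 6.2.

Axiom closure of the theorem below: `propext`, `Classical.choice`, `Quot.sound`; no named fact remains on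
this path.

## References

* T. Tao, *The logarithmically averaged Chowla and Elliott conjectures for two-point correlations*, Forum
  Math. Pi 4 (2016), e8, doi:10.1017/fmp.2016.6 = arXiv:1509.05422: §1 (paragraph after Remark 1.6),
  Corollary 1.5, Theorem 1.3, §2 (Theorem 2.3, Proposition 2.4), §3. [TaoFMP2016]
* K. Matomäki, M. Radziwiłł, T. Tao, *An averaged form of Chowla's conjecture*, Algebra & Number Theory 9
  (2015), 2167–2196: Theorem 1.7, Appendix A (Theorem A.2, Proposition A.3, Lemma A.4).
  [MatomakiRadziwillTao2015]
* A. Ivić, *The Riemann zeta-function* (1985), Theorems 6.1–6.2, Lemma 6.3. [Ivic1985]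

## Design choices

* A sibling file rather than an append to `ParityWave0.lean`: the proof imports modules that themselves
  import `ParityWave0.lean` (house pattern of `ParityWave0PolymathHolds.lean`).
-/

namespace Literature.NumberTheory.Sieve

/-- **Tao 2016, `∑_{n ≤ x} μ(n) μ(n+h)/n = o(log x)` for every `h ≥ 1`, PROVED**: the Wave-0 named fact
`tao_log_chowla_moebius` (parity.S21, Möbius form) DISCHARGED along the printed deduction — the
Vinogradov–Korobov zero-free region (`LFunctions.VKZeta.exists_hasVKZeroFreeRegion`, from Vinogradov's mean
value theorem) fed into `LFunctions.MRT2015.tao_log_chowla_moebius_of_vk` (Matomäki–Radziwiłł–Tao 2015,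
Prop. A.3 / Thm A.2 / Thm 1.7; Tao 2016, Proposition 2.4, Theorem 2.3, Theorem 1.3, Corollary 1.5 applied to
the non-pretentious `μ`). All axioms standard.
[cite: TaoFMP2016, §1 (paragraph after Remark 1.6) and Corollary 1.5] -/
theorem tao_log_chowla_moebius_holds : tao_log_chowla_moebius := by
  obtain ⟨c, hc, hVK⟩ := LFunctions.VKZeta.exists_hasVKZeroFreeRegion
  exact LFunctions.MRT2015.tao_log_chowla_moebius_of_vk hc hVK

end Literature.NumberTheory.Sieve
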